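import Literature.MathematicalPhysics.QuantumFieldTheory.Balaban1983to89.B9Eq3133H1kPiTwoBackgroundLetterTower
import Literature.MathematicalPhysics.QuantumFieldTheory.Balaban1983to89.B9Eq3130GtildeMinusG1kGradRowsClosed
import Literature.MathematicalPhysics.QuantumFieldTheory.Balaban1983to89.B9Eq386BondPropagatorTwoBackgroundGradientLetterTower

/-!
# `Balaban1983to89.B9Eq3130GtildeTwoBackgroundLetterTower` — T. Bałaban, *Propagators for lattice gauge theories in a background field*, Commun. Math. Phys. **99** (1985) 389–434
# [Balaban1985BackgroundPropagators] (3.130)–(3.131) pp. 421–422, (3.122) p. 420, (3.84)–(3.86) p. 407, Thm 3.4 p. 400, Thm 3.13 p. 426, (3.3) p. 391: **THE TWO-BACKGROUND LADDER OF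
# PRINT's `G̃_k = Δ̃_{a,k}⁻¹` (operator (3.122)) AT THE FLAT BASE — value, covariant-gradient and FLAT-gradient letters of `G̃_k(U)f − G_k(1)f` with the small factor `j₀ + α`,
# constants BEFORE `n, η, m, U`** — the sum of gen 101's slot-difference rows `B9Eq3130GtildeMinusG1kGradRowsClosed` (`G̃_k(U) − G_k(U)`, at the radius `max(α, j₀)`) and the bond
# storey `B9Eq386BondPropagatorTwoBackground{,Gradient}LetterTower` (`G_k(U) − G_k(1)`, gen 100∕101); `G̃_k(1) = G_k(1)` (`B9Eq3119DeltaPiTowerFlat`), so this IS the ladder of print's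
# `G̃_k`: the first word of the `𝔊̃_k` storey and the `G`-letter of the chart actually instantiated

statement-level skeleton of published theorems with citation tags; proofs where landed; nothing here is a claim about the Yang–Mills mass gap

CITATION HEADER (lean-in-tree rule).  Audit cell `pub-balaban`, sub-cell `t4`, BINDER row NE9; filed by NE9 crux-team LEAF PROVER 01 (`b2b-balaban-t4-ne9-formalise-leaf-01`, gen 101;
ROUTE (J′), π-side, the `𝔊̃` storey (first word); bears_on: R4/N22).  Composition BY NAME: gen 101's `exists_local_rows_G1kPi_sub_G1k`; gen 100∕101's `exists_letter_G1k_sub_flat`,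
`exists_gradLetter_G1k_sub_flat`; ne9-leaf-04's `B9Eq373TransporterLipschitzLetters.norm_adTransportW_sub_adTransportW_le`; `B5Eq172HodgePositivity.adTransportW_one`; `B9Eq33CovDerivVector.covGrad`
(linear, `covGrad_apply`).  Source READ first-hand in the held text layer `paper:balaban1985-cmp99-background-propagators` (journal page = PDF page + 388) pp. 391, 400, 407, 420–422.  NOTHING
of print's proofs is reproduced: [folklore] triangle inequalities + one transporter difference.

WHAT IS PROVED (sorry-free; proof lane — 0 `def`; [folklore]).
* **`exists_letters_G1kPi_sub_flat`** — `∃ α₁ j₁ > 0, K ≥ 0, κ > 0` BEFORE the binder block of `B9Eq3133H1kPiTwoBackgroundLetterTower.exists_letter_H1kPi_sub_flat` (`hαL`, `hQ` idle here)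
  with fine-bond one-block sources `f` over `v` (`‖f‖_∞ ≤ F`) `+ (μ : Fin d)`: `‖((G̃_k(U) − G_k(1))f)(b)‖ ≤ (j₀ + α)·K·e^{−κ·d_m(Π(b₋),v)}·F`,
  `‖(∇_U(G̃_k(U) − G_k(1))f)(b, μ)‖, ‖(∇_1(G̃_k(U) − G_k(1))f)(b, μ)‖ ≤ (j₀ + α)·K·e^{−κ·d_m(Π(b₊),v)}·F`.
HONEST SCOPE.  Composition BY NAME on the cell's MODEL rows (O-NE9-1, #5 UNRULED); constants crude; `j₀` and `α` displayed separately; the windows, `c₀ = η^d`, unitarity, the tower data, the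
positivity witnesses stay HYPOTHESES; nothing of [B9] (3.130)–(3.133) ∕ Thm 3.4 ∕ 3.13 asserted as printed; «NE9 ⇐ the named binders»; NE9 NOT PRINTED ∕ NOT PROVED; spine PROVED 0∕9; rung (B)+1 on a
finite T⁴ — NOT infinite volume, NOT mass gap, NOT BetaPertH, NOT Clay.  HONEST DEPENDENCY: continuum YM on T⁴ ⇐ BetaPertH ∧ nine spine estimates (0/9 proved); BetaPertH ⇐ (D1) ∧ (D4) ∧
CAP+tail; G-an2-4 gates asym, D1 and NE2/3/4.  NEW file; nothing modified.  Net new unproved facts: 0.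
-/

noncomputable section

open scoped InnerProductSpace ComplexConjugate BigOperators

namespace Literature.MathematicalPhysics.QuantumFieldTheory.Balaban1983to89.B9Eq3130GtildeTwoBackgroundLetterTower

open B4Sect5Torus (TSite tdist tdist_nonneg)
open B9SectCLatticeCarrier (Bond bpos btgt shift unshift)
open B9Eq311L2Pairing (WL2)
open B9Eq319QprimeTorus (blockCoord)
open B7Prop1Explicit (U1 Wcx boxVec)
open B11Eq103H1Complex (SiteL2K BondL2K G1LatticeK)
open B9Eq33CovDerivVector (covGrad covGrad_apply)
open B9Eq310DeltaPrime (plaqHolU)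
open B9Eq310HessianOperator (adTransportW)
open B9Eq315QTorus (perCfg cornerSite)
open B9Eq315QTower (towerP UlevOf)
open B9Eq315QTowerFlat (perCfg_UlevOf_one_mem_U1 norm_Wcx_UlevOf_one_sub_one_le)
open B9Eq316TowerFlatIsOneStep (towerP_eq_fineP_pow siteCast)
open B9Eq326OperatorTower (QkW laplaceAk G1k)
open B9Eq324DeltaPrimeATower (laplacePrimeAk)
open B9Eq3119DeltaPiTower (laplaceAkPi)
open B9Eq373TransporterLipschitzLetters (norm_adTransportW_sub_adTransportW_le)
open B9Eq3130GtildeMinusG1kGradRowsClosed (exists_local_rows_G1kPi_sub_G1k)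
open B9Eq386BondPropagatorTwoBackgroundLetterTower (exists_letter_G1k_sub_flat)
open B9Eq386BondPropagatorTwoBackgroundGradientLetterTower (exists_gradLetter_G1k_sub_flat)

variable {d : ℕ} (hd : 1 ≤ d) (L : ℕ) [NeZero L] (hL : 1 ≤ L) (hL3 : 3 ≤ L)
  {𝔸 : Type*} [NormedRing 𝔸] [NormedAlgebra ℂ 𝔸] [CompleteSpace 𝔸] [NormOneClass 𝔸] [StarRing 𝔸] [NormedStarGroup 𝔸] [StarModule ℂ 𝔸] [FiniteDimensional ℂ 𝔸]
  {W : Type*} [NormedAddCommGroup W] [InnerProductSpace ℂ W] [FiniteDimensional ℂ W] (φ : W ≃ₗ[ℂ] 𝔸)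
  {Mφ Mφ' : ℝ} (hMφ : 0 ≤ Mφ) (hMφ' : 0 ≤ Mφ') (hφ : ∀ w, ‖φ w‖ ≤ Mφ * ‖w‖) (hφ' : ∀ X, ‖φ.symm X‖ ≤ Mφ' * ‖X‖) (hstar : ∀ X : 𝔸, ‖star X‖ ≤ ‖X‖)
  {a : ℝ} (ha : 0 < a) {a' : ℝ} (ha' : 0 < a') {ϱ : ℝ} (hϱ0 : 0 ≤ ϱ) (hϱ1 : ϱ < 1)
  (τ : 𝔸 →ₗ[ℂ] ℂ) {Cτ : ℝ} (hτ : ∀ X, ‖τ X‖ ≤ Cτ * ‖X‖) (hCτ : 0 ≤ Cτ) {Mτ : ℝ} (hτm : ∀ X Y : 𝔸, ‖τ (X * Y)‖ ≤ Mτ * ‖X‖ * ‖Y‖) (hMτ : 0 ≤ Mτ)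
  {ρw : ℝ} (hρw : 0 ≤ ρw)
  (hτ₁ : ∀ X : 𝔸, τ (star X) = conj (τ X)) (hτ₂ : ∀ X Y : 𝔸, τ (X * Y) = τ (Y * X)) (hφτ : ∀ X Y : 𝔸, ⟪φ.symm X, φ.symm Y⟫_ℂ = τ (star X * Y))
  (AQ : ℝ)
  {ι : Type} [Fintype ι] [DecidableEq ι] (b : Module.Basis ι ℝ 𝔸) {M₂ : ℝ} (hM₂ : 0 ≤ M₂) (hrepr : ∀ (v : 𝔸) (i : ι), |b.repr v i| ≤ M₂ * ‖v‖)

include hd hL hL3 hMφ hMφ' hφ hφ' hstar ha ha' hϱ0 hϱ1 hτ hCτ hτm hMτ hρw hτ₁ hτ₂ hφτ hM₂ hrepr in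
set_option maxHeartbeats 3200000 in
set_option maxRecDepth 8192 in
/-- **THE TWO-BACKGROUND LADDER OF PRINT's `G̃_k` AT THE FLAT BASE (value, `∇_U`, `∇_1`)** — see the module docstring. [folklore]
[cite: Balaban1985BackgroundPropagators, (3.130)–(3.131) pp.421–422, (3.122) p.420, (3.84)–(3.86) p.407, Thm 3.4 p.400, (3.3) p.391] -/
theorem exists_letters_G1kPi_sub_flat :
    ∃ α₁ j₁ K κ : ℝ, 0 < α₁ ∧ 0 < j₁ ∧ 0 ≤ K ∧ 0 < κ ∧
      ∀ (n : ℕ) (η : ℝ) (_hηL : η * (L : ℝ) ^ (n + 1) = 1) (c₀ c₁ : ℝ) [Fact (0 < c₀)] [Fact (0 < c₁)]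
        (_hw : c₀ * ((L : ℝ) ^ (n + 1)) ^ d = c₁) (_hρ : |η| ^ d / c₀ ≤ ρw) (m : Fin d → ℕ) [∀ i, NeZero (m i)] (_hm : ∀ i, 1 ≤ m i)
        (U : Bond d (towerP L m (n + 1)) → 𝔸ˣ) (αU : ℕ → ℝ) (_hα0 : ∀ j, 0 ≤ αU j) (hα1 : ∀ j, αU j ≤ 1 / 64)
        (_hαL : ∀ j, 50 * (d + 1) * αU j * (L : ℝ) ^ d ≤ 1 / 2)
        (hU1 : ∀ (j : ℕ) (x : B7Prop1Explicit.Site d) (k : Fin d), perCfg (towerP L m (j + 1)) (UlevOf L m (n + 1) U j) x k ∈ U1 𝔸)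
        (hreg : ∀ (j : ℕ) (y : TSite d (towerP L m j)) (k : Fin d) (ρ' : Fin d → Fin L),
          ‖((Wcx L (perCfg (towerP L m (j + 1)) (UlevOf L m (n + 1) U j)) (cornerSite L y) k (boxVec L ρ') : 𝔸ˣ) : 𝔸) - 1‖ ≤ αU j)
        (εU : ℕ → ℝ) (_hεU : ∀ j, 0 ≤ εU j) (_hε1 : ∀ j, εU j ≤ 1) (_hUε : ∀ (j : ℕ) (b : Bond d (towerP L m (j + 1))), ‖(UlevOf L m (n + 1) U j b : 𝔸) - 1‖ ≤ εU j)
        (_hLb : ∀ (j : ℕ) (b : Bond d (towerP L m (j + 1))), UlevOf L m (n + 1) U j b ∈ U1 𝔸)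
        (α : ℝ) (_hα : 0 ≤ α) (_hαle : α ≤ α₁)
        (hUst : ∀ b, star (U b : 𝔸) = (((U b)⁻¹ : 𝔸ˣ) : 𝔸)) (_hUb : ∀ b, U b ∈ U1 𝔸) (_hUη : ∀ b, ‖(U b : 𝔸) - 1‖ ≤ α * η)
        (_hUw : ∀ (x : TSite d (towerP L m (n + 1))) (μ ν : Fin d), ‖(U (shift ν x, μ) : 𝔸) - (U (x, μ) : 𝔸)‖ ≤ α * η ^ 2)
        (_hpl : ∀ p : B9SectCLatticeCarrier.Plaq d (towerP L m (n + 1)), ‖(plaqHolU U p : 𝔸) - 1‖ ≤ α * η ^ 2)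
        (_hUgrad : ∀ (x : TSite d (towerP L m (n + 1))) (μ : Fin d), ‖(U (x, μ) : 𝔸) - U (unshift μ x, μ)‖ ≤ α * η ^ 2)
        (_hRlev : ∀ (j : ℕ) (b : Bond d (towerP L m (j + 1))) (w : W), ‖adTransportW φ (UlevOf L m (n + 1) U j) b w‖ ≤ ‖w‖)
        (_hεg : ∀ j < n + 1, εU j ≤ α * ϱ ^ j) (_hAQ : ∑ j ∈ Finset.range (n + 1), αU j ≤ AQ)
        (hpos' : ∀ x : SiteL2K ℂ d (towerP L m (n + 1)) c₀ W, x ≠ 0 → 0 < RCLike.re ⟪x, laplacePrimeAk L m n φ η U a' (c₁ := c₁) x⟫_ℂ)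
        (hpos : ∀ x : BondL2K ℂ d (towerP L m (n + 1)) c₀ W, x ≠ 0 →
          0 < RCLike.re ⟪x, laplaceAk L m n φ η U hL αU hα1 hU1 hreg τ (c₀ := c₀) (c₁ := c₁) a x⟫_ℂ)
        (_hc₀η : c₀ = η ^ d) (j₀ : ℝ) (_hJ : ∀ μ y, ‖B9Eq39Adjoint.J (fun μ => B9Eq33CovDerivVector.shiftEquiv μ) (fun μ y => U (y, μ)) η μ y‖ ≤ j₀) (_hj : j₀ ≤ j₁)
        (hposπ : ∀ x : BondL2K ℂ d (towerP L m (n + 1)) c₀ W, x ≠ 0 →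
          0 < RCLike.re ⟪x, laplaceAkPi L m n φ τ η U a' hpos' hL αU hα1 hU1 hreg (c₁ := c₁) a x⟫_ℂ)
        (_hQ : Function.Surjective (QkW L m n φ U hL αU hα1 hU1 hreg (c₀ := c₀) (c₁ := c₁)))
        (hpos'₁ : ∀ x : SiteL2K ℂ d (towerP L m (n + 1)) c₀ W, x ≠ 0 →
          0 < RCLike.re ⟪x, laplacePrimeAk L m n φ η (fun _ : Bond d (towerP L m (n + 1)) => (1 : 𝔸ˣ)) a' (c₁ := c₁) x⟫_ℂ)
        (hpos₁ : ∀ x : BondL2K ℂ d (towerP L m (n + 1)) c₀ W, x ≠ 0 →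
          0 < RCLike.re ⟪x, laplaceAk L m n φ η (fun _ : Bond d (towerP L m (n + 1)) => (1 : 𝔸ˣ)) hL (fun _ => 0) (fun _ => by norm_num)
            (perCfg_UlevOf_one_mem_U1 L m (n + 1)) (norm_Wcx_UlevOf_one_sub_one_le L m (n + 1) (fun _ => 0) (fun _ => le_rfl)) τ
            (c₀ := c₀) (c₁ := c₁) a x⟫_ℂ)
        (v : TSite d m) (f : BondL2K ℂ d (towerP L m (n + 1)) c₀ W) (F : ℝ)
        (_hfv : ∀ b', blockCoord (L ^ (n + 1)) m (siteCast (towerP_eq_fineP_pow L m (n + 1)) (bpos b')) ≠ v → WL2.equiv ℂ (fun _ : Bond d (towerP L m (n + 1)) => c₀) W f b' = 0)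
        (_hfF : ∀ b', ‖WL2.equiv ℂ (fun _ : Bond d (towerP L m (n + 1)) => c₀) W f b'‖ ≤ F) (μ : Fin d) (bd : Bond d (towerP L m (n + 1))),
        ‖WL2.equiv ℂ (fun _ : Bond d (towerP L m (n + 1)) => c₀) W (G1LatticeK hposπ f -
              G1k L m n φ η (fun _ : Bond d (towerP L m (n + 1)) => (1 : 𝔸ˣ)) hL (fun _ => 0) (fun _ => by norm_num)
                (perCfg_UlevOf_one_mem_U1 L m (n + 1)) (norm_Wcx_UlevOf_one_sub_one_le L m (n + 1) (fun _ => 0) (fun _ => le_rfl)) τ (c₀ := c₀) (c₁ := c₁) hpos₁ f) bd‖ ≤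
          (j₀ + α) * K * Real.exp (-(κ * tdist m (blockCoord (L ^ (n + 1)) m (siteCast (towerP_eq_fineP_pow L m (n + 1)) (bpos bd))) v)) * F ∧
        ‖covGrad ((η : ℂ))⁻¹ (adTransportW φ U) (WL2.equiv ℂ (fun _ : Bond d (towerP L m (n + 1)) => c₀) W (G1LatticeK hposπ f -
              G1k L m n φ η (fun _ : Bond d (towerP L m (n + 1)) => (1 : 𝔸ˣ)) hL (fun _ => 0) (fun _ => by norm_num)
                (perCfg_UlevOf_one_mem_U1 L m (n + 1)) (norm_Wcx_UlevOf_one_sub_one_le L m (n + 1) (fun _ => 0) (fun _ => le_rfl)) τ (c₀ := c₀) (c₁ := c₁) hpos₁ f)) (bd, μ)‖ ≤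
          (j₀ + α) * K * Real.exp (-(κ * tdist m (blockCoord (L ^ (n + 1)) m (siteCast (towerP_eq_fineP_pow L m (n + 1)) (btgt bd))) v)) * F ∧
        ‖covGrad ((η : ℂ))⁻¹ (adTransportW φ (fun _ : Bond d (towerP L m (n + 1)) => (1 : 𝔸ˣ))) (WL2.equiv ℂ (fun _ : Bond d (towerP L m (n + 1)) => c₀) W (G1LatticeK hposπ f -
              G1k L m n φ η (fun _ : Bond d (towerP L m (n + 1)) => (1 : 𝔸ˣ)) hL (fun _ => 0) (fun _ => by norm_num)
                (perCfg_UlevOf_one_mem_U1 L m (n + 1)) (norm_Wcx_UlevOf_one_sub_one_le L m (n + 1) (fun _ => 0) (fun _ => le_rfl)) τ (c₀ := c₀) (c₁ := c₁) hpos₁ f)) (bd, μ)‖ ≤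
          (j₀ + α) * K * Real.exp (-(κ * tdist m (blockCoord (L ^ (n + 1)) m (siteCast (towerP_eq_fineP_pow L m (n + 1)) (btgt bd))) v)) * F := by
  classical
  obtain ⟨αR, BR, δR, hαR, hBR, hδR, HR⟩ :=
    exists_local_rows_G1kPi_sub_G1k hd L hL hL3 φ hMφ hMφ' hφ hφ' hstar ha ha' hϱ0 hϱ1 τ hτ hCτ hτm hMτ hρw hτ₁ hτ₂ hφτ AQ
  obtain ⟨αS, KS, κS, hαS, hKS, hκS, HS⟩ :=
    exists_letter_G1k_sub_flat hd L hL hL3 φ hMφ hMφ' hφ hφ' hstar ha ha' hϱ0 hϱ1 τ hτ hCτ hτm hMτ hρw hτ₁ hτ₂ hφτ b hM₂ hrepr AQ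
  obtain ⟨αG, KG, κG, hαG, hKG, hκG, HG⟩ :=
    exists_gradLetter_G1k_sub_flat hd L hL hL3 φ hMφ hMφ' hφ hφ' hstar ha ha' hϱ0 hϱ1 τ hτ hCτ hτm hMτ hρw hτ₁ hτ₂ hφτ b hM₂ hrepr AQ
  set κ₀ : ℝ := min δR (min κS κG) with hκ₀
  have hκ₀0 : 0 < κ₀ := lt_min hδR (lt_min hκS hκG)
  have hκ₀R : κ₀ ≤ δR := min_le_left _ _
  have hκ₀S : κ₀ ≤ κS := (min_le_right _ _).trans (min_le_left _ _)
  have hκ₀G : κ₀ ≤ κG := (min_le_right _ _).trans (min_le_right _ _)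
  set K : ℝ := (BR + KS) + (BR + KG) + 2 * Mφ * Mφ' * (BR + KS) with hK
  have hK0 : 0 ≤ K := by positivity
  refine ⟨min (min αR αS) (min αG 1), αR, K, κ₀, lt_min (lt_min hαR hαS) (lt_min hαG one_pos), hαR, hK0, hκ₀0, ?_⟩
  intro n η hηL c₀ c₁ _ _ hw hρ m _ hm U αU hα0 hα1 _ hU1 hreg εU hεU hε1 hUε hLb α hα hαle hUst hUb hUη hUw hpl hUgrad hRlev hεg hAQ hpos' hpos hc₀η j₀ hJ hj
    hposπ _ hpos'₁ hpos₁ v f F hfv hfF μ bd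
  have hαR' : α ≤ αR := hαle.trans ((min_le_left _ _).trans (min_le_left _ _))
  have hαS' : α ≤ αS := hαle.trans ((min_le_left _ _).trans (min_le_right _ _))
  have hαG' : α ≤ αG := hαle.trans ((min_le_right _ _).trans (min_le_left _ _))
  have hα1' : α ≤ 1 := hαle.trans ((min_le_right _ _).trans (min_le_right _ _))
  have hLpos : (0 : ℝ) < (L : ℝ) ^ (n + 1) := pow_pos (by exact_mod_cast Nat.pos_of_ne_zero (NeZero.ne L)) _
  have hη : 0 < η := by
    by_contra h; push Not at h; nlinarith [mul_nonpos_of_nonpos_of_nonneg h hLpos.le]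
  have hcn : ‖((η : ℂ))⁻¹‖ = η⁻¹ := by rw [norm_inv, Complex.norm_real, Real.norm_eq_abs, abs_of_pos hη]
  have y₀ : TSite d (towerP L m (n + 1)) := fun _ => 0
  have hF : 0 ≤ F := (norm_nonneg _).trans (hfF bd)
  have hj₀ : 0 ≤ j₀ := (norm_nonneg _).trans (hJ ⟨0, hd⟩ y₀)
  -- the enlarged radius `α′ = max α j₀` for the slot-difference rows
  set α' : ℝ := max α j₀ with hα'
  have hα'0 : 0 ≤ α' := hα.trans (le_max_left _ _)
  have hαα' : α ≤ α' := le_max_left _ _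
  have hα'R : α' ≤ αR := max_le hαR' hj
  have hα'le : α' ≤ j₀ + α := max_le (by linarith) (by linarith)
  have hUη' : ∀ b', ‖(U b' : 𝔸) - 1‖ ≤ α' * η := fun b' => (hUη b').trans (by gcongr)
  have hpl' : ∀ p : B9SectCLatticeCarrier.Plaq d (towerP L m (n + 1)), ‖(plaqHolU U p : 𝔸) - 1‖ ≤ α' * η ^ 2 := fun p => (hpl p).trans (by gcongr)
  have hUgrad' : ∀ (x : TSite d (towerP L m (n + 1))) (μ' : Fin d), ‖(U (x, μ') : 𝔸) - U (unshift μ' x, μ')‖ ≤ α' * η ^ 2 := fun x μ' =>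
    (hUgrad x μ').trans (by gcongr)
  have hεg' : ∀ j < n + 1, εU j ≤ α' * ϱ ^ j := fun j hj' => (hεg j hj').trans (mul_le_mul_of_nonneg_right hαα' (pow_nonneg hϱ0 j))
  have hJ' : ∀ (μ' : Fin d) (y : TSite d (towerP L m (n + 1))),
      ‖B9Eq39Adjoint.J (fun μ => B9Eq33CovDerivVector.shiftEquiv μ) (fun μ y => U (y, μ)) η μ' y‖ ≤ α' := fun μ' y => (hJ μ' y).trans (le_max_right _ _)
  -- names and the two suppliers at this source
  set GU := G1k L m n φ η U hL αU hα1 hU1 hreg τ (c₀ := c₀) (c₁ := c₁) hpos with hGU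
  set DB : ℝ := tdist m (blockCoord (L ^ (n + 1)) m (siteCast (towerP_eq_fineP_pow L m (n + 1)) (bpos bd))) v with hDB
  set DT : ℝ := tdist m (blockCoord (L ^ (n + 1)) m (siteCast (towerP_eq_fineP_pow L m (n + 1)) (btgt bd))) v with hDT
  have hDB0 : 0 ≤ DB := tdist_nonneg _ _ _
  have hDT0 : 0 ≤ DT := tdist_nonneg _ _ _
  have hweak : ∀ {r' : ℝ} (t : ℝ), κ₀ ≤ r' → 0 ≤ t → Real.exp (-(r' * t)) ≤ Real.exp (-(κ₀ * t)) := fun t hr ht => Real.exp_le_exp.mpr (by nlinarith)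
  have HRb := HR n η hηL c₀ c₁ hw hρ m hm U αU hα0 hα1 hU1 hreg εU hεU hUε hLb α' hα'0 hα'R hUst hUb hUη' hpl' hUgrad' hRlev hεg' hAQ hpos' hpos hposπ hc₀η hJ'
    v f F hfv hfF μ bd y₀
  have HRt := HR n η hηL c₀ c₁ hw hρ m hm U αU hα0 hα1 hU1 hreg εU hεU hUε hLb α' hα'0 hα'R hUst hUb hUη' hpl' hUgrad' hRlev hεg' hAQ hpos' hpos hposπ hc₀η hJ'
    v f F hfv hfF μ (btgt bd, μ) y₀
  have HSb := HS n η hηL c₀ c₁ hw hρ m hm U α hα hαS' hUb hUη hUw hpl hUst αU hα0 hα1 hAQ hU1 hreg εU hεU hε1 hεg hUε hLb hRlev hpos' hpos hpos'₁ hpos₁ v f F hfv hfF bd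
  have HSt := HS n η hηL c₀ c₁ hw hρ m hm U α hα hαS' hUb hUη hUw hpl hUst αU hα0 hα1 hAQ hU1 hreg εU hεU hε1 hεg hUε hLb hRlev hpos' hpos hpos'₁ hpos₁ v f F hfv hfF
    (btgt bd, μ)
  have HGb := HG n η hηL c₀ c₁ hw hρ m hm U α hα hαG' hUb hUη hUw hpl hUst αU hα0 hα1 hAQ hU1 hreg εU hεU hε1 hεg hUε hLb hRlev hpos' hpos hpos'₁ hpos₁ v f F hfv hfF μ bd
  -- the algebraic split `G̃_U f − G_1 f = (G̃_U f − G_U f) + (G_U f − G_1 f)`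
  have hsplit : G1LatticeK hposπ f - G1k L m n φ η (fun _ : Bond d (towerP L m (n + 1)) => (1 : 𝔸ˣ)) hL (fun _ => 0) (fun _ => by norm_num)
                (perCfg_UlevOf_one_mem_U1 L m (n + 1)) (norm_Wcx_UlevOf_one_sub_one_le L m (n + 1) (fun _ => 0) (fun _ => le_rfl)) τ (c₀ := c₀) (c₁ := c₁) hpos₁ f =
      (G1LatticeK hposπ f - GU f) + (GU f - G1k L m n φ η (fun _ : Bond d (towerP L m (n + 1)) => (1 : 𝔸ˣ)) hL (fun _ => 0) (fun _ => by norm_num)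
                (perCfg_UlevOf_one_mem_U1 L m (n + 1)) (norm_Wcx_UlevOf_one_sub_one_le L m (n + 1) (fun _ => 0) (fun _ => le_rfl)) τ (c₀ := c₀) (c₁ := c₁) hpos₁ f) := (sub_add_sub_cancel _ _ _).symm
  -- (i) the value letter at `Π(b₋)` (and at the bond `(b₊, μ)`, for the flat correction)
  have hval : ∀ (b' : Bond d (towerP L m (n + 1))) (D : ℝ), 0 ≤ D →
      D = tdist m (blockCoord (L ^ (n + 1)) m (siteCast (towerP_eq_fineP_pow L m (n + 1)) (bpos b'))) v →
      ‖WL2.equiv ℂ (fun _ : Bond d (towerP L m (n + 1)) => c₀) W (G1LatticeK hposπ f - GU f) b'‖ ≤ α' * BR * Real.exp (-(δR * tdist m (blockCoord (L ^ (n + 1)) m (siteCast (towerP_eq_fineP_pow L m (n + 1)) (bpos b'))) v)) * F →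
      ‖WL2.equiv ℂ (fun _ : Bond d (towerP L m (n + 1)) => c₀) W (GU f - G1k L m n φ η (fun _ : Bond d (towerP L m (n + 1)) => (1 : 𝔸ˣ)) hL (fun _ => 0) (fun _ => by norm_num)
                (perCfg_UlevOf_one_mem_U1 L m (n + 1)) (norm_Wcx_UlevOf_one_sub_one_le L m (n + 1) (fun _ => 0) (fun _ => le_rfl)) τ (c₀ := c₀) (c₁ := c₁) hpos₁ f) b'‖ ≤ KS * α * Real.exp (-(κS * tdist m (blockCoord (L ^ (n + 1)) m (siteCast (towerP_eq_fineP_pow L m (n + 1)) (bpos b'))) v)) * F →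
      ‖WL2.equiv ℂ (fun _ : Bond d (towerP L m (n + 1)) => c₀) W (G1LatticeK hposπ f - G1k L m n φ η (fun _ : Bond d (towerP L m (n + 1)) => (1 : 𝔸ˣ)) hL (fun _ => 0) (fun _ => by norm_num)
                (perCfg_UlevOf_one_mem_U1 L m (n + 1)) (norm_Wcx_UlevOf_one_sub_one_le L m (n + 1) (fun _ => 0) (fun _ => le_rfl)) τ (c₀ := c₀) (c₁ := c₁) hpos₁ f) b'‖ ≤ (j₀ + α) * (BR + KS) * Real.exp (-(κ₀ * D)) * F := by
    intro b' D hD0 hD h1 h2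
    rw [← hD] at h1 h2
    rw [hsplit, WL2.equiv_add, Pi.add_apply]
    have h1' := h1.trans (mul_le_mul_of_nonneg_right (mul_le_mul_of_nonneg_left (hweak _ hκ₀R hD0) (mul_nonneg hα'0 hBR)) hF)
    have h2' := h2.trans (mul_le_mul_of_nonneg_right (mul_le_mul_of_nonneg_left (hweak _ hκ₀S hD0) (mul_nonneg hKS hα)) hF)
    refine (norm_add_le _ _).trans ((add_le_add h1' h2').trans ?_)
    have hE0 : 0 ≤ Real.exp (-(κ₀ * D)) := Real.exp_nonneg _
    have hx : α' * BR ≤ (j₀ + α) * BR := mul_le_mul_of_nonneg_right hα'le hBR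
    have hy : KS * α ≤ (j₀ + α) * KS := by nlinarith
    have hEF : 0 ≤ Real.exp (-(κ₀ * D)) * F := mul_nonneg hE0 hF
    have e : (j₀ + α) * (BR + KS) * Real.exp (-(κ₀ * D)) * F = ((j₀ + α) * BR + (j₀ + α) * KS) * (Real.exp (-(κ₀ * D)) * F) := by ring
    rw [e]
    have e1 : α' * BR * Real.exp (-(κ₀ * D)) * F + KS * α * Real.exp (-(κ₀ * D)) * F = (α' * BR + KS * α) * (Real.exp (-(κ₀ * D)) * F) := by ring
    rw [e1]
    exact mul_le_mul_of_nonneg_right (add_le_add hx hy) hEF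
  have hiB := hval bd DB hDB0 hDB HRb.1 HSb
  have hiT := hval (btgt bd, μ) DT hDT0 hDT HRt.1 HSt
  -- (ii) the covariant gradient at `U`
  set A : Bond d (towerP L m (n + 1)) → W := WL2.equiv ℂ (fun _ : Bond d (towerP L m (n + 1)) => c₀) W (G1LatticeK hposπ f - G1k L m n φ η (fun _ : Bond d (towerP L m (n + 1)) => (1 : 𝔸ˣ)) hL (fun _ => 0) (fun _ => by norm_num)
                (perCfg_UlevOf_one_mem_U1 L m (n + 1)) (norm_Wcx_UlevOf_one_sub_one_le L m (n + 1) (fun _ => 0) (fun _ => le_rfl)) τ (c₀ := c₀) (c₁ := c₁) hpos₁ f) with hA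
  have hii : ‖covGrad ((η : ℂ))⁻¹ (adTransportW φ U) A (bd, μ)‖ ≤ (j₀ + α) * (BR + KG) * Real.exp (-(κ₀ * DT)) * F := by
    rw [hA, hsplit, WL2.equiv_add, map_add, Pi.add_apply]
    have h1 := HRb.2.2.2.trans (mul_le_mul_of_nonneg_right (mul_le_mul_of_nonneg_left (hweak _ hκ₀R hDT0) (mul_nonneg hα'0 hBR)) hF)
    have h2 := HGb.2.1.trans (mul_le_mul_of_nonneg_right (mul_le_mul_of_nonneg_left (hweak _ hκ₀G hDT0) (mul_nonneg hKG hα)) hF)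
    rw [WL2.equiv_sub] at h1 h2
    rw [WL2.equiv_sub, WL2.equiv_sub]
    refine (norm_add_le _ _).trans ((add_le_add h1 h2).trans ?_)
    have hE0 : 0 ≤ Real.exp (-(κ₀ * DT)) := Real.exp_nonneg _
    have hx : α' * BR ≤ (j₀ + α) * BR := mul_le_mul_of_nonneg_right hα'le hBR
    have hy : KG * α ≤ (j₀ + α) * KG := by nlinarith
    have hEF : 0 ≤ Real.exp (-(κ₀ * DT)) * F := mul_nonneg hE0 hF
    have e : (j₀ + α) * (BR + KG) * Real.exp (-(κ₀ * DT)) * F = ((j₀ + α) * BR + (j₀ + α) * KG) * (Real.exp (-(κ₀ * DT)) * F) := by ring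
    have e1 : α' * BR * Real.exp (-(κ₀ * DT)) * F + KG * α * Real.exp (-(κ₀ * DT)) * F = (α' * BR + KG * α) * (Real.exp (-(κ₀ * DT)) * F) := by ring
    rw [e, e1]
    exact mul_le_mul_of_nonneg_right (add_le_add hx hy) hEF
  -- (iii) the flat gradient: `∇_1 = ∇_U + η⁻¹(1 − R(U(b)))(·)(b₊)` against the value letter at `b₊`
  have hUb1 : ∀ b' : Bond d (towerP L m (n + 1)), (fun _ : Bond d (towerP L m (n + 1)) => (1 : 𝔸ˣ)) b' ∈ U1 𝔸 := fun _ => one_mem _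
  have hRε : ∀ w : W, ‖adTransportW φ U bd w - w‖ ≤ 2 * Mφ * Mφ' * (α * η) * ‖w‖ := fun w => by
    have h := norm_adTransportW_sub_adTransportW_le φ hφ hφ' hMφ' U (fun _ : Bond d (towerP L m (n + 1)) => (1 : 𝔸ˣ)) bd bd (hUb bd) (hUb1 bd) w
    rw [B5Eq172HodgePositivity.adTransportW_one, LinearMap.id_apply, Units.val_one] at h
    exact h.trans (by gcongr; exact hUη bd)
  have e3 : covGrad ((η : ℂ))⁻¹ (adTransportW φ (fun _ : Bond d (towerP L m (n + 1)) => (1 : 𝔸ˣ))) A (bd, μ) =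
      covGrad ((η : ℂ))⁻¹ (adTransportW φ U) A (bd, μ) + ((η : ℂ))⁻¹ • (A (btgt bd, μ) - adTransportW φ U bd (A (btgt bd, μ))) := by
    rw [covGrad_apply, covGrad_apply, B5Eq172HodgePositivity.adTransportW_one, LinearMap.id_apply, ← smul_add]
    congr 1
    abel
  have hcorr : ‖((η : ℂ))⁻¹ • (A (btgt bd, μ) - adTransportW φ U bd (A (btgt bd, μ)))‖ ≤ 2 * Mφ * Mφ' * ((j₀ + α) * (BR + KS)) * Real.exp (-(κ₀ * DT)) * F := by
    rw [norm_smul, hcn, norm_sub_rev]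
    have hv : ‖A (btgt bd, μ)‖ ≤ (j₀ + α) * (BR + KS) * Real.exp (-(κ₀ * DT)) * F := hiT
    calc η⁻¹ * ‖adTransportW φ U bd (A (btgt bd, μ)) - A (btgt bd, μ)‖
        ≤ η⁻¹ * (2 * Mφ * Mφ' * (α * η) * ((j₀ + α) * (BR + KS) * Real.exp (-(κ₀ * DT)) * F)) := by
          refine mul_le_mul_of_nonneg_left ((hRε _).trans ?_) (inv_nonneg.2 hη.le)
          exact mul_le_mul_of_nonneg_left hv (by positivity)
      _ = 2 * Mφ * Mφ' * ((j₀ + α) * (BR + KS)) * α * Real.exp (-(κ₀ * DT)) * F * (η⁻¹ * η) := by ring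
      _ ≤ 2 * Mφ * Mφ' * ((j₀ + α) * (BR + KS)) * 1 * Real.exp (-(κ₀ * DT)) * F * 1 := by
          rw [inv_mul_cancel₀ hη.ne']
          have hE0 : 0 ≤ Real.exp (-(κ₀ * DT)) := Real.exp_nonneg _
          gcongr
      _ = 2 * Mφ * Mφ' * ((j₀ + α) * (BR + KS)) * Real.exp (-(κ₀ * DT)) * F := by ring
  have hiii : ‖covGrad ((η : ℂ))⁻¹ (adTransportW φ (fun _ : Bond d (towerP L m (n + 1)) => (1 : 𝔸ˣ))) A (bd, μ)‖ ≤ (j₀ + α) * K * Real.exp (-(κ₀ * DT)) * F := by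
    rw [e3]
    refine (norm_add_le _ _).trans ((add_le_add hii hcorr).trans ?_)
    have hE0 : 0 ≤ Real.exp (-(κ₀ * DT)) := Real.exp_nonneg _
    have hx : 0 ≤ (j₀ + α) * (BR + KS) * (Real.exp (-(κ₀ * DT)) * F) := by positivity
    have hring : (j₀ + α) * K * Real.exp (-(κ₀ * DT)) * F = (j₀ + α) * (BR + KG) * Real.exp (-(κ₀ * DT)) * F +
        2 * Mφ * Mφ' * ((j₀ + α) * (BR + KS)) * Real.exp (-(κ₀ * DT)) * F + (j₀ + α) * (BR + KS) * (Real.exp (-(κ₀ * DT)) * F) := by rw [hK]; ring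
    rw [hring]
    linarith
  have hKB : (j₀ + α) * (BR + KS) * Real.exp (-(κ₀ * DB)) * F ≤ (j₀ + α) * K * Real.exp (-(κ₀ * DB)) * F := by
    have : 0 ≤ (j₀ + α) * ((BR + KG) + 2 * Mφ * Mφ' * (BR + KS)) * (Real.exp (-(κ₀ * DB)) * F) := by positivity
    have hring : (j₀ + α) * K * Real.exp (-(κ₀ * DB)) * F = (j₀ + α) * (BR + KS) * Real.exp (-(κ₀ * DB)) * F +
        (j₀ + α) * ((BR + KG) + 2 * Mφ * Mφ' * (BR + KS)) * (Real.exp (-(κ₀ * DB)) * F) := by rw [hK]; ring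
    rw [hring]; linarith
  have hKT : (j₀ + α) * (BR + KG) * Real.exp (-(κ₀ * DT)) * F ≤ (j₀ + α) * K * Real.exp (-(κ₀ * DT)) * F := by
    have : 0 ≤ (j₀ + α) * ((BR + KS) + 2 * Mφ * Mφ' * (BR + KS)) * (Real.exp (-(κ₀ * DT)) * F) := by positivity
    have hring : (j₀ + α) * K * Real.exp (-(κ₀ * DT)) * F = (j₀ + α) * (BR + KG) * Real.exp (-(κ₀ * DT)) * F +
        (j₀ + α) * ((BR + KS) + 2 * Mφ * Mφ' * (BR + KS)) * (Real.exp (-(κ₀ * DT)) * F) := by rw [hK]; ring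
    rw [hring]; linarith
  exact ⟨hiB.trans hKB, hii.trans hKT, hiii⟩

end Literature.MathematicalPhysics.QuantumFieldTheory.Balaban1983to89.B9Eq3130GtildeTwoBackgroundLetterTower

end
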